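import Mathlib
import Summits.MatrixMultiplication.MatrixMultiplication.Theorems.SubgroupIdentityDesigns.Negative.PrincipalSeriesBudget
import Summits.MatrixMultiplication.MatrixMultiplication.Theorems.SubgroupIdentityDesigns.Negative.WitnessWindow
import Summits.MatrixMultiplication.MatrixMultiplication.Theorems.SubgroupIdentityDesigns.Negative.LevelOneDegree

/-!
# The exact level-one budget of `GL_m(𝔽_p)` and the master level-one squeeze
(support lemma for the crux `SubgroupIdentityDesigns`, stmt-MatrixMultiplication-14079; cell B2b-5
`b2b-lgcu-borel`, gen 11 — report `run/shared/lean/b2b/levelgraded-cu/ORACLE-g11.md` §G11-3e)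

`PrincipalSeriesBudget.budget_ge` prices the level-one space `F_1` of `G = GL_{1+l}(𝔽_p)` by the
`p − 1` characters `Ind_P^G 1 − 1` and `π_χ` (`χ ≠ 1`), each bounded below by `p^l`.  Here the degrees
are made EXACT: the line stabiliser `P = lineStab i₀` is the stabiliser of a point of `ℙ(𝔽_p^{1+l})`
(`lineStab_eq_stabilizer`), so `[G : P] · (p − 1) = p^{1+l} − 1` (`card_quotient_lineStab_mul`, from
the transitivity `LevelOneDegree.isPretransitive_proj` and `Projectivization.card`), whence
`π_χ(1) = [m]_p = (p^m − 1)/(p − 1)` and `(Ind_P^G 1 − 1)(1) = (p^m − p)/(p − 1)` (`m = 1 + l`); adding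
the trivial character gives the EXACT FULL LEVEL-ONE FLOOR (`budget_ge_exact`)
`budget(p, m, 1, s) ≥ 1 + ((p^m − p)/(p−1))^s + (p − 2)·((p^m − 1)/(p−1))^s`
— these `p` characters are all of `Irr(G) ∩ F_1` (the constituents of the permutation module on
`𝔽_p^m ∖ 0`), so this is the whole level-one budget.  Against the wall ceiling `2V² ≤ N_1³`,
`N_1 (p−1) ≤ p^{2m}` (`WitnessWindow`) a level-one witness of the crux at `ε` forces the MASTER
INEQUALITY (`levelOne_master`; `s = 2 + ε`, `a = (p^m−p)/(p−1)`, `b = (p^m−1)/(p−1)`)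
`(1 + a^s + (p−2) b^s) · 2^{s/6} · (p−1)^{s/2} < (p^m)^s`;
`no_levelOne_witness_master` is its contrapositive (corollaries for `p = 2`, `m ≥ 3` in
`Negative/LevelOneCorollaries.lean`).  Float instances of the largest admissible `ε`:
`(p,m) = (3,3): 0.25`, `(3,4): 0.58`, `(5,2): 0.10`, `(5,3): 0.24`, `(7,2): 0.17`, `(7,3): 0.24`,
`(11,·): 0.21`, `(101,·): 0.105`; the inequality FAILS for every `ε` exactly at the four cells
`(m,p) ∈ {(2,2), (3,2), (4,2), (2,3)}` (groups of order `6, 168, 20160, 48`), and as `p → ∞` the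
admissible band shrinks like `0.46/ln p` — walls + full level-one pricing cannot do better there.
Sorry-free.  VALUE = exact constants + uniform no-go theorem, NOT summit progress; the crux item
(stmt-MatrixMultiplication-14079) stays open.
-/

set_option linter.dupNamespace false

noncomputable section

open scoped BigOperators Matrix Classical

namespace Summit.MatrixMultiplication.MatrixMultiplication.Theorems.SubgroupIdentityDesigns.Negative
namespace LevelOneExact

open LineStabilizer (lineStab mem_lineStab_iff)
open LevelOneDegree (isPretransitive_proj)

section General

variable {F : Type} [Field F] [Fintype F] [DecidableEq F] {n : ℕ} (i₀ : Fin n)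

omit [Fintype F] [DecidableEq F] in
/-- The standard basis vector `e_{i₀}` is non-zero. -/
theorem single_ne_zero : (Pi.single i₀ (1 : F) : Fin n → F) ≠ 0 := by
  intro h
  have := congr_fun h i₀
  simp at this

omit [Fintype F] [DecidableEq F] in
/-- **`P = Stab([e_{i₀}])`**: the line stabiliser is the stabiliser of the point `[e_{i₀}]` of
`ℙ(F^n)` under `GL_n(F)`. -/
theorem lineStab_eq_stabilizer :
    lineStab (F := F) i₀ = MulAction.stabilizer (GL (Fin n) F)
      (Projectivization.mk F (Pi.single i₀ (1 : F) : Fin n → F) (single_ne_zero i₀)) := by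
  ext g
  rw [MulAction.mem_stabilizer_iff, Projectivization.smul_mk, Projectivization.mk_eq_mk_iff,
    mem_lineStab_iff]
  have hg : g • (Pi.single i₀ (1 : F) : Fin n → F) =
      (g : Matrix (Fin n) (Fin n) F) *ᵥ Pi.single i₀ 1 := by
    rw [Units.smul_def, Matrix.smul_eq_mulVec]
  constructor
  · rintro ⟨a, ha⟩
    have ha0 : a ≠ 0 := by
      rintro rfl
      rw [zero_smul] at ha
      have h2 := congr_arg (fun v => ((g⁻¹ : GL (Fin n) F) : Matrix (Fin n) (Fin n) F) *ᵥ v) ha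
      simp only [Matrix.mulVec_mulVec, Matrix.mulVec_zero, ← Units.val_mul, inv_mul_cancel,
        Units.val_one, Matrix.one_mulVec] at h2
      exact single_ne_zero i₀ h2
    refine ⟨Units.mk0 a ha0, ?_⟩
    rw [hg, ha, Units.smul_mk0]
  · rintro ⟨u, hu⟩
    exact ⟨(u : F), by rw [← hg, ← hu, Units.smul_def]⟩

/-- **EXACT INDEX OF THE LINE STABILISER**: `[GL_n(F) : P] · (q − 1) = q^n − 1`. -/
theorem card_quotient_lineStab_mul :
    Fintype.card (GL (Fin n) F ⧸ lineStab (F := F) i₀) * (Fintype.card F - 1) =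
      Fintype.card F ^ n - 1 := by
  haveI := isPretransitive_proj F n
  rw [← Nat.card_eq_fintype_card, ← Subgroup.index_eq_card, lineStab_eq_stabilizer,
    MulAction.index_stabilizer_of_transitive]
  have h := Projectivization.card (k := F) (V := Fin n → F)
  rw [Nat.card_eq_fintype_card (α := Fin n → F), Fintype.card_fun, Fintype.card_fin,
    Nat.card_eq_fintype_card (α := F)] at h
  exact h.symm

end General

section ZModP

open Literature.RepresentationTheory.FiniteGroups
open Literature.Barriers.MatrixMultiplication (SubgroupTPP)
open Summit.MatrixMultiplication.MatrixMultiplication.Theorems.LieRankDesigns.Negative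
  (GLm Mat levelSet budget trivial_mem_levelSet character_trivial_apply re_apply_one_nonneg)
open LineStabilizerCharacter (theta_sub_triv_one)
open PrincipalSeriesOne (psChar psChar_one)
open PrincipalSeriesIrreducible (psChar_ne)
open PrincipalSeriesBudget (psChar_mem steinberg_mem card_mulChar)
open BlockSliceDesignOne (i0)
open WitnessWindow (window card_rankLE_one_mul_le)

variable {p : ℕ} [hp : Fact p.Prime] {l : ℕ}

/-- `[G : P] = (p^{1+l} − 1)/(p − 1)` as a real number (`G = GL_{1+l}(𝔽_p)`, `P = lineStab i0`). -/
theorem card_quotient_real :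
    ((Fintype.card (GLm p (1 + l) ⧸ lineStab (F := ZMod p) (i0 : Fin (1 + l))) : ℕ) : ℝ) =
      ((p : ℝ) ^ (1 + l) - 1) / ((p : ℝ) - 1) := by
  have hp2 : 2 ≤ p := hp.out.two_le
  have hp1R : (0 : ℝ) < (p : ℝ) - 1 := by
    have : (2 : ℝ) ≤ p := by exact_mod_cast hp2
    linarith
  have h := card_quotient_lineStab_mul (F := ZMod p) (i0 : Fin (1 + l))
  rw [ZMod.card] at h
  have h1 : 1 ≤ p ^ (1 + l) := Nat.one_le_pow _ _ hp.out.pos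
  have hR := congr_arg (fun n : ℕ => (n : ℝ)) h
  simp only [Nat.cast_mul, Nat.cast_sub hp.out.one_lt.le, Nat.cast_sub h1, Nat.cast_pow,
    Nat.cast_one] at hR
  rw [eq_div_iff hp1R.ne', hR]

/-- **THE EXACT FULL LEVEL-ONE FLOOR**: for `l ≥ 1` and every real `s`,
`budget(p, 1+l, 1, s) ≥ 1 + ((p^{1+l} − p)/(p−1))^s + (p − 2)·((p^{1+l} − 1)/(p−1))^s`
(trivial character, `Ind_P^G 1 − 1`, and the `p − 2` principal-series characters `π_χ`, with their
exact degrees). -/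
theorem budget_ge_exact (hl : 1 ≤ l) (s : ℝ) :
    1 + (((p : ℝ) ^ (1 + l) - p) / ((p : ℝ) - 1)) ^ s +
        ((p : ℝ) - 2) * (((p : ℝ) ^ (1 + l) - 1) / ((p : ℝ) - 1)) ^ s ≤ budget p (1 + l) 1 s := by
  letI : Fintype (MulChar (ZMod p) ℂ) := Fintype.ofFinite _
  have hp2 : 2 ≤ p := hp.out.two_le
  have hpR : (2 : ℝ) ≤ p := by exact_mod_cast hp2
  have hp1R : (0 : ℝ) < (p : ℝ) - 1 := by linarith
  have hfin : (irrChars (GLm p (1 + l)) ∩ levelSet p (1 + l) 1).Finite :=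
    (irrChars_finite_holds (GLm p (1 + l))).subset Set.inter_subset_left
  -- names for the three kinds of characters
  set triv : GLm p (1 + l) → ℂ := (Representation.trivial ℂ (GLm p (1 + l)) ℂ).character with htriv
  set St : GLm p (1 + l) → ℂ := ((indClassFun (G := GLm p (1 + l)) (lineStab (F := ZMod p)
      (i0 : Fin (1 + l))) (fun _ => (1 : ℂ))) - (Representation.character (Representation.trivial ℂ
      (GLm p (1 + l)) ℂ)) : (GLm p (1 + l)) → ℂ) with hSt
  set ps : MulChar (ZMod p) ℂ → (GLm p (1 + l) → ℂ) := fun χ => ((psChar (F := ZMod p) (i0 : Fin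
      (1 + l))) χ : (GLm p (1 + l)) → ℂ) with hps
  set T : Finset (MulChar (ZMod p) ℂ) := Finset.univ.erase (1 : MulChar (ZMod p) ℂ) with hT
  -- exact degrees (real parts at `1`)
  have hQ := card_quotient_real (p := p) (l := l)
  have hdeg_triv : (triv 1).re = 1 := by rw [htriv, character_trivial_apply, Complex.one_re]
  have hdeg_St : (St 1).re = ((p : ℝ) ^ (1 + l) - p) / ((p : ℝ) - 1) := by
    rw [hSt, theta_sub_triv_one]
    simp only [Complex.sub_re, Complex.natCast_re, Complex.one_re]
    rw [hQ, eq_div_iff hp1R.ne', sub_mul, div_mul_cancel₀ _ hp1R.ne']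
    ring
  have hdeg_ps : ∀ χ, (ps χ 1).re = ((p : ℝ) ^ (1 + l) - 1) / ((p : ℝ) - 1) := by
    intro χ
    rw [hps]
    simp only [psChar_one, Complex.natCast_re]
    exact hQ
  -- the degrees separate the three kinds
  have hpl : (p : ℝ) < (p : ℝ) ^ (1 + l) := by
    have : (p : ℝ) ^ 1 < (p : ℝ) ^ (1 + l) := pow_lt_pow_right₀ (by linarith) (by omega)
    simpa using this
  have hP2 : (p : ℝ) ^ 2 ≤ (p : ℝ) ^ (1 + l) := pow_le_pow_right₀ (by linarith) (by omega)
  have hSt_gt : 1 < (St 1).re := by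
    rw [hdeg_St, lt_div_iff₀ hp1R]
    nlinarith [hP2, hpR]
  have hSt_ne_triv : St ≠ triv := by
    intro h
    have := congr_arg (fun f : GLm p (1 + l) → ℂ => (f 1).re) h
    rw [hdeg_triv] at this
    linarith
  have htriv_notin : triv ∉ T.image ps := by
    intro h
    obtain ⟨χ, _, hχ⟩ := Finset.mem_image.mp h
    have := congr_arg (fun f : GLm p (1 + l) → ℂ => (f 1).re) hχ
    rw [hdeg_ps, hdeg_triv, div_eq_iff hp1R.ne'] at this
    nlinarith [hP2, hpR]
  have hSt_notin : St ∉ insert triv (T.image ps) := by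
    rw [Finset.mem_insert, not_or]
    refine ⟨hSt_ne_triv, fun h => ?_⟩
    obtain ⟨χ, _, hχ⟩ := Finset.mem_image.mp h
    have := congr_arg (fun f : GLm p (1 + l) → ℂ => (f 1).re) hχ
    rw [hdeg_ps, hdeg_St, div_eq_iff hp1R.ne', div_mul_cancel₀ _ hp1R.ne'] at this
    linarith
  have hinj : Set.InjOn ps ↑T := by
    intro χ hχ χ' _ e
    by_contra hne
    exact psChar_ne (i0 : Fin (1 + l)) (Finset.ne_of_mem_erase (Finset.mem_coe.mp hχ)) hne e
  -- all of them lie in `Irr ∩ F_1`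
  have hsub : insert St (insert triv (T.image ps)) ⊆ hfin.toFinset := by
    intro ψ hψ
    rw [Set.Finite.mem_toFinset]
    rcases Finset.mem_insert.mp hψ with rfl | hψ
    · exact steinberg_mem hl
    rcases Finset.mem_insert.mp hψ with rfl | hψ
    · exact trivial_mem_levelSet (p := p) (m := 1 + l) 1
    · obtain ⟨χ, hχ, rfl⟩ := Finset.mem_image.mp hψ
      exact psChar_mem (Finset.ne_of_mem_erase hχ)
  have hcount : T.card = p - 2 := by
    rw [hT, Finset.card_erase_of_mem (Finset.mem_univ _), Finset.card_univ, ← Nat.card_eq_fintype_card,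
      card_mulChar]
    omega
  have hcountR : (T.card : ℝ) = (p : ℝ) - 2 := by
    rw [hcount, Nat.cast_sub hp2]; norm_num
  -- assemble
  calc 1 + (((p : ℝ) ^ (1 + l) - p) / ((p : ℝ) - 1)) ^ s +
        ((p : ℝ) - 2) * (((p : ℝ) ^ (1 + l) - 1) / ((p : ℝ) - 1)) ^ s
      = (St 1).re ^ s + ((triv 1).re ^ s + ∑ χ ∈ T, (ps χ 1).re ^ s) := by
        rw [hdeg_St, hdeg_triv, Real.one_rpow, Finset.sum_congr rfl fun χ _ => by rw [hdeg_ps χ],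
          Finset.sum_const, nsmul_eq_mul, hcountR]
        ring
    _ = (St 1).re ^ s + ((triv 1).re ^ s + ∑ ψ ∈ T.image ps, (ψ 1).re ^ s) := by
        rw [Finset.sum_image hinj]
    _ = (St 1).re ^ s + ∑ ψ ∈ insert triv (T.image ps), (ψ 1).re ^ s := by
        rw [Finset.sum_insert htriv_notin]
    _ = ∑ ψ ∈ insert St (insert triv (T.image ps)), (ψ 1).re ^ s := by
        rw [Finset.sum_insert hSt_notin]
    _ ≤ ∑ ψ ∈ hfin.toFinset, (ψ 1).re ^ s :=
        Finset.sum_le_sum_of_subset_of_nonneg hsub fun ψ hψ _ =>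
          Real.rpow_nonneg (re_apply_one_nonneg (hfin.mem_toFinset.mp hψ).1) s
    _ = budget p (1 + l) 1 s := by
        unfold budget
        rw [finsum_mem_eq_finite_toFinset_sum _ hfin]

/-- **THE MASTER LEVEL-ONE SQUEEZE.**  A level-one witness of the crux at `ε` in `GL_{1+l}(𝔽_p)`,
`l ≥ 1`, forces, with `s = 2 + ε`, `a = (p^{1+l} − p)/(p−1)`, `b = (p^{1+l} − 1)/(p−1)`:
`(1 + a^s + (p−2) b^s) · 2^{s/6} · (p−1)^{s/2} < (p^{1+l})^s`
(exact full level-one floor below `V^{s/3}`, walls `2V² ≤ N_1³`, `N_1 (p−1) ≤ p^{2(1+l)}` above). -/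
theorem levelOne_master (hl : 1 ≤ l) {ε : ℝ} (hε : 0 < ε)
    {H₁ H₂ H₃ : Subgroup (GLm p (1 + l))} (htpp : SubgroupTPP H₁ H₂ H₃)
    (hdes : ∃ c : Mat p (1 + l) → ℂ, (∀ M, 1 < M.rank → c M = 0) ∧
      (∑ M, c M * ZMod.stdAddChar (Matrix.trace (M * ((1 : GLm p (1 + l)) : Mat p (1 + l))))) = 1 ∧
      ∀ a ∈ H₁, ∀ b ∈ H₂, ∀ g ∈ H₃, a * b * g ≠ 1 →
        (∑ M, c M * ZMod.stdAddChar
          (Matrix.trace (M * ((a * b * g : GLm p (1 + l)) : Mat p (1 + l))))) = 0)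
    (hlt : budget p (1 + l) 1 (2 + ε) <
      ((Nat.card H₁ * Nat.card H₂ * Nat.card H₃ : ℕ) : ℝ) ^ ((2 + ε) / 3)) :
    (1 + (((p : ℝ) ^ (1 + l) - p) / ((p : ℝ) - 1)) ^ (2 + ε) +
        ((p : ℝ) - 2) * (((p : ℝ) ^ (1 + l) - 1) / ((p : ℝ) - 1)) ^ (2 + ε)) *
      (2 : ℝ) ^ ((2 + ε) / 6) * ((p : ℝ) - 1) ^ ((2 + ε) / 2) < ((p : ℝ) ^ (1 + l)) ^ (2 + ε) := by
  obtain ⟨-, hceil⟩ := window (k := 1) (l := l) hε htpp hdes hlt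
  set s : ℝ := 2 + ε with hs_def
  have hs : 0 < s := by rw [hs_def]; linarith
  set V : ℕ := Nat.card H₁ * Nat.card H₂ * Nat.card H₃ with hV_def
  have hp2 : 2 ≤ p := hp.out.two_le
  have hpR : (2 : ℝ) ≤ p := by exact_mod_cast hp2
  have hp1 : (0 : ℝ) < (p : ℝ) - 1 := by linarith
  set Fl : ℝ := 1 + (((p : ℝ) ^ (1 + l) - p) / ((p : ℝ) - 1)) ^ s +
      ((p : ℝ) - 2) * (((p : ℝ) ^ (1 + l) - 1) / ((p : ℝ) - 1)) ^ s with hFl_def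
  -- floor
  have hfl : Fl < (V : ℝ) ^ (s / 3) := (budget_ge_exact (p := p) hl s).trans_lt hlt
  -- ceiling: `2 V² (p-1)^3 ≤ p^{6(1+l)}`
  have hN := card_rankLE_one_mul_le (p := p) (m := 1 + l) (by omega)
  have hce : 2 * V ^ 2 * (p - 1) ^ 3 ≤ p ^ (6 * (1 + l)) := by
    calc 2 * V ^ 2 * (p - 1) ^ 3 ≤ (Fintype.card {M : Mat p (1 + l) // M.rank ≤ 1}) ^ 3 * (p - 1) ^ 3 :=
          Nat.mul_le_mul_right _ hceil
      _ = (Fintype.card {M : Mat p (1 + l) // M.rank ≤ 1} * (p - 1)) ^ 3 := by ring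
      _ ≤ (p ^ (2 * (1 + l))) ^ 3 := Nat.pow_le_pow_left hN 3
      _ = p ^ (6 * (1 + l)) := by rw [← pow_mul]; ring_nf
  have hceR : 2 * (V : ℝ) ^ 2 * ((p : ℝ) - 1) ^ 3 ≤ (p : ℝ) ^ (6 * (1 + l)) := by
    have h1 : (1 : ℕ) ≤ p := hp.out.one_lt.le
    have h := (Nat.cast_le (α := ℝ)).mpr hce
    push_cast [Nat.cast_sub h1] at h
    exact h
  have hV0 : (0 : ℝ) ≤ (V : ℝ) := Nat.cast_nonneg _
  have hVsq : (V : ℝ) ^ 2 ≤ (p : ℝ) ^ (6 * (1 + l)) / (2 * ((p : ℝ) - 1) ^ 3) := by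
    rw [le_div_iff₀ (by positivity)]
    linarith
  -- `V^{s/3} = (V²)^{s/6} ≤ (p^{6m}/(2(p-1)^3))^{s/6} = (p^m)^s / (2^{s/6} (p-1)^{s/2})`
  have hVs : (V : ℝ) ^ (s / 3) = ((V : ℝ) ^ 2) ^ (s / 6) := by
    rw [← Real.rpow_natCast (V : ℝ) 2, ← Real.rpow_mul hV0]
    congr 1; push_cast; ring
  have hup : ((V : ℝ) ^ 2) ^ (s / 6) ≤ ((p : ℝ) ^ (6 * (1 + l)) / (2 * ((p : ℝ) - 1) ^ 3)) ^ (s / 6) :=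
    Real.rpow_le_rpow (by positivity) hVsq (by positivity)
  set P : ℝ := (p : ℝ) ^ (1 + l) with hP_def
  have hP0 : 0 < P := by positivity
  have hrhs : ((p : ℝ) ^ (6 * (1 + l)) / (2 * ((p : ℝ) - 1) ^ 3)) ^ (s / 6) =
      P ^ s / ((2 : ℝ) ^ (s / 6) * ((p : ℝ) - 1) ^ (s / 2)) := by
    rw [Real.div_rpow (by positivity) (by positivity), Real.mul_rpow (by norm_num) (by positivity)]
    have e3 : ((p : ℝ) ^ (6 * (1 + l))) ^ (s / 6) = P ^ s := by
      rw [show (p : ℝ) ^ (6 * (1 + l)) = P ^ 6 by rw [hP_def, ← pow_mul]; ring_nf,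
        ← Real.rpow_natCast P 6, ← Real.rpow_mul hP0.le]
      congr 1; push_cast; ring
    have e4 : (((p : ℝ) - 1) ^ 3) ^ (s / 6) = ((p : ℝ) - 1) ^ (s / 2) := by
      rw [← Real.rpow_natCast ((p : ℝ) - 1) 3, ← Real.rpow_mul hp1.le]
      congr 1; push_cast; ring
    rw [e3, e4]
  rw [hVs] at hfl
  rw [hrhs] at hup
  have hlt2 := hfl.trans_le hup
  have hden : 0 < (2 : ℝ) ^ (s / 6) * ((p : ℝ) - 1) ^ (s / 2) := by positivity
  rw [lt_div_iff₀ hden] at hlt2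
  linarith [hlt2]

/-- **NO LEVEL-ONE WITNESS UNDER THE MASTER INEQUALITY** (contrapositive of `levelOne_master`):
if `(p^{1+l})^{2+ε} ≤ (1 + a^{2+ε} + (p−2) b^{2+ε}) · 2^{(2+ε)/6} · (p−1)^{(2+ε)/2}` then no subgroup
triple of `GL_{1+l}(𝔽_p)` carrying a level-one identity design satisfies the crux inequality at `ε`.
Float instances (largest admissible `ε`): `(p,m)=(3,3): 0.25`, `(5,2): 0.10`, `(7,2): 0.17`,
`(3,4): 0.58`; it FAILS for every `ε` exactly at `(m,p) ∈ {(2,2),(3,2),(4,2),(2,3)}`. -/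
theorem no_levelOne_witness_master (hl : 1 ≤ l) {ε : ℝ} (hε : 0 < ε)
    (hthr : ((p : ℝ) ^ (1 + l)) ^ (2 + ε) ≤
      (1 + (((p : ℝ) ^ (1 + l) - p) / ((p : ℝ) - 1)) ^ (2 + ε) +
          ((p : ℝ) - 2) * (((p : ℝ) ^ (1 + l) - 1) / ((p : ℝ) - 1)) ^ (2 + ε)) *
        (2 : ℝ) ^ ((2 + ε) / 6) * ((p : ℝ) - 1) ^ ((2 + ε) / 2))
    {H₁ H₂ H₃ : Subgroup (GLm p (1 + l))} (htpp : SubgroupTPP H₁ H₂ H₃)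
    (hdes : ∃ c : Mat p (1 + l) → ℂ, (∀ M, 1 < M.rank → c M = 0) ∧
      (∑ M, c M * ZMod.stdAddChar (Matrix.trace (M * ((1 : GLm p (1 + l)) : Mat p (1 + l))))) = 1 ∧
      ∀ a ∈ H₁, ∀ b ∈ H₂, ∀ g ∈ H₃, a * b * g ≠ 1 →
        (∑ M, c M * ZMod.stdAddChar
          (Matrix.trace (M * ((a * b * g : GLm p (1 + l)) : Mat p (1 + l))))) = 0) :
    ¬ budget p (1 + l) 1 (2 + ε) <
      ((Nat.card H₁ * Nat.card H₂ * Nat.card H₃ : ℕ) : ℝ) ^ ((2 + ε) / 3) :=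
  fun hlt => absurd (levelOne_master hl hε htpp hdes hlt) (not_lt.mpr hthr)

end ZModP

end LevelOneExact
end Summit.MatrixMultiplication.MatrixMultiplication.Theorems.SubgroupIdentityDesigns.Negative
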